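import Mathlib
import HarnessLib
import Summits.CriticalPhenomena.Statement
import Literature.Probability.RandomPlanarGeometry.RestrictionHulls
import Summits.CriticalPhenomena.SAWScalingLimit.Theorems.SAWLoopFugacityFlowSimpleSubseqLimitsFarReturnLine

/-!
# Scratch (lead c4): the promotable v4 statement `SlitAvoidanceItem` in ROUTE-FILE vocabulary

Elaboration check that the cleanest self-contained statement of the crux's residual
(`PastFutureAvoidance ∧ BoundaryDecay`, Theorems file `…SimpleSubseqLimitsPastFuturePinned.lean`),
written with FULLY QUALIFIED Literature names exactly as a route item signature must be, elaborates in
the import/open context of the route file `Theses/SAWLoopFugacityFlow.lean` (same four imports, same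
`open` lines; the fifth import is only for the `Iff.rfl` comparison below). Not for landing.
-/

open scoped BigOperators Topology Manifold Classical MeasureTheory ProbabilityTheory Matrix InnerProductSpace ComplexConjugate ContinuousMap
open Filter Set Function TopologicalSpace MeasureTheory

/-- The item text (paste as the signature of the promoted item). -/
def SAWSlitAndBoundaryAvoidance : Prop :=
  (∀ (D : Literature.Probability.RandomPlanarGeometry.DobrushinDomain) (a b : ℝ → Literature.Probability.LatticeModels.Site 2), Literature.Probability.RandomPlanarGeometry.SAW.IsEndpointApprox D a b → ∀ (q : ℂ) (r θ : ℝ), 0 < r → 0 < θ → ∃ ε r' : ℝ, 0 < ε ∧ r < r' ∧ r' ≤ 5 * r ∧ ∀ᶠ δ in nhdsWithin 0 (Set.Ioi 0), Literature.Probability.RandomPlanarGeometry.SAW.law D.carrier δ (a δ) (b δ) {γ | ∃ v τ t' : unitInterval, v < τ ∧ τ ≤ t' ∧ (⟨γ.walk.toCurve (Literature.Probability.LatticeModels.meshPoint δ)⟩ : Literature.Probability.RandomPlanarGeometry.Curve ℂ) τ ∈ Metric.closedBall q r' ∧ (∀ u : unitInterval, u < τ → (⟨γ.walk.toCurve (Literature.Probability.LatticeModels.meshPoint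 δ)⟩ : Literature.Probability.RandomPlanarGeometry.Curve ℂ) u ∉ Metric.closedBall q r') ∧ (∀ u : unitInterval, u ≤ v → 5 * r < dist ((⟨γ.walk.toCurve (Literature.Probability.LatticeModels.meshPoint δ)⟩ : Literature.Probability.RandomPlanarGeometry.Curve ℂ) u) q) ∧ dist ((⟨γ.walk.toCurve (Literature.Probability.LatticeModels.meshPoint δ)⟩ : Literature.Probability.RandomPlanarGeometry.Curve ℂ) t') ((⟨γ.walk.toCurve (Literature.Probability.LatticeModels.meshPoint δ)⟩ : Literature.Probability.RandomPlanarGeometry.Curve ℂ) v) < ε} ≤ ENNReal.ofReal θ) ∧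
  (∀ (D : Literature.Probability.RandomPlanarGeometry.DobrushinDomain) (a b : ℝ → Literature.Probability.LatticeModels.Site 2), Literature.Probability.RandomPlanarGeometry.SAW.IsEndpointApprox D a b → ∀ ρ θ : ℝ, 0 < ρ → 0 < θ → ∃ ε : ℝ, 0 < ε ∧ ∀ᶠ δ in nhdsWithin 0 (Set.Ioi 0), Literature.Probability.RandomPlanarGeometry.SAW.law D.carrier δ (a δ) (b δ) {γ | ∃ γ' : Literature.Probability.RandomPlanarGeometry.Curve ℂ, Literature.Probability.RandomPlanarGeometry.CurveClass.mk γ' = γ.curve ∧ ∃ t : unitInterval, Metric.infDist (γ' t) (frontier D.carrier) < ε ∧ ρ < dist (γ' t) (D.pt 0) ∧ ρ < dist (γ' t) (D.pt 1)} ≤ ENNReal.ofReal θ)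

-- the item text IS `PastFutureAvoidance ∧ BoundaryDecay` (definitional)
example : SAWSlitAndBoundaryAvoidance ↔
    (Summit.CriticalPhenomena.SAWScalingLimit.Theorems.SimpleSubseqLimits.FarPast.Line.PastFutureAvoidance ∧
      Summit.CriticalPhenomena.SAWScalingLimit.Theorems.SimpleSubseqLimits.Boundary.Passage.BoundaryDecay) :=
  Iff.rfl
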